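import Summits.NavierStokesRegularity.NavierStokesRegularity.Theses.AxisymmetricExtremality
import Summits.NavierStokesRegularity.NavierStokesRegularity.Theorems.AxisymmetricExtremalityAxisymmetricKatoGlobalStubSereginLogSwirlOriginStep3SwirlSource
import Summits.NavierStokesRegularity.NavierStokesRegularity.Theorems.AxisymmetricExtremalityAxisymmetricKatoGlobalStubSereginLogSwirlOriginStep3Gamma
import Summits.NavierStokesRegularity.NavierStokesRegularity.Theorems.AxisymmetricExtremalityAxisymmetricKatoGlobalStubSereginLogSwirlOriginStep3Balance
import HarnessLib

/-!
# Seregin 2022, §2 Step 3: the absorption and the key estimate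
# `sup_t ∫η⁶(Γ² + Φ²) + ∫∫(η³|∇Γ|)² + (η³|∇Φ|)² ≤ C` modulo the printed bound of `A₃` —
# crux stmt-NavierStokesRegularity-15453 (`AxisymmetricExtremality.AxisymmetricKatoGlobal`), line registered, support for stub `stub_sereginLogSwirlOrigin`

Support file (`--supports stmt-NavierStokesRegularity-15453`; theorems only, everything proved)
toward the registered stub `stub_sereginLogSwirlOrigin` = the named fact
`Literature.Analysis.FluidPDE.seregin2022_logSwirl_regularAtOrigin` (G. Seregin, J. Math. Fluid
Mech. 24 (2022), Paper 27 = arXiv:2201.00153, §2). Step 3, after the two `η⁶`-weighted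
identities (`…Step3Gamma`, `…Step3Integrated`), estimates `A₁ + B₁`, `A₂ + B₂` by `C(v,η)`
(boundedness of `v`, `∇ω` on `supp ∇η`), then
"`B₃ = −2∫_{S₁}(v_θ/r)(η³Φ)(η³Γ) + (1/r₁)C(v,η) ≤ (cC₁/ln(e/r₁))(∫|η³Γ|²/(r²ln²(e/r)))^{1/2}
(∫|η³Φ|²/(r²ln²(e/r)))^{1/2} + … ≤ (cC₁/ln(e/r₁))‖∇_{x'}(η³Γ)‖‖∇_{x'}(η³Φ)‖ + …`" by (2.2) and
Lemma 2.2, bounds `A₃` with Lemma 2.1, and concludes under the smallness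
`cC₁/ln(e/r₁) + cC₁²/ln⁴(e/r₁) < 2` "by more or less standard arguments" the key estimate
`sup_t∫η⁶(|Γ|² + |Φ|²) + ∫_Q(η³|∇Φ|)² + (η³|∇Γ|)² ≤ C(v,η,r₁)` (arXiv pp. 6–7). This file proves:

* `integral_horizontal_gradSq_le`, `continuousOn_integral_gradSq_cutoff` — bookkeeping;
* `cutoff_energy_apriori` (registered sub-goal) — **the absorbed a-priori inequality** along a
  classical axisymmetric solution on a slab: with `E = ∫(ζΓ)² + ∫(ζΦ)²`,
  `D = ∫|∇(ζΓ)|² + ∫|∇(ζΦ)|²`, `θ = 8C₁/ln(e/r₁) + θ_A`: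
  `E(t) + (2ν − θ)∫_{t₁}^t D ≤ E(t₁) + (Bcut + B_A + 4M|B(0,2)|)(t − t₁)`, the cut-off terms being
  bounded by the numeric hypothesis `Bcut` and `A₃` by the printed form `2A₃ ≤ θ_A D + B_A`;
* `cutoff_energy_keyEstimate` (registered sub-goal) — **the key estimate** under the smallness
  `8C₁/ln(e/r₁) + θ_A < 2ν`: `sup_{[t₁,t₂]} E ≤ K` and `∫_{t₁}^{t₂} D ≤ K/(2ν − θ)`,
  `K = E(t₁) + (Bcut + B_A + 4M|B(0,2)|)(t₂ − t₁)`.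

What remains of Step 3 after this file: the two numeric hypotheses — `Bcut` from sup-norm bounds
of `v, ∇v, ∇²v, ∇ω` on `supp ∇η` (routine), and the `A₃`-bound `2A₃ ≤ θ_A D + B_A` with
`θ_A = cC₁²/ln⁴(e/r₁)` (the paper's `A₃ = A₀ + A'₃₁ + A₃₂` manipulation with Lemma 2.1 and Lemma 2.2).

## Mathlib / tree search

Tree: `abs_integral_angVelQuot_mul_mul_le`, `log_exp_div_eq` (`…Step3SwirlSource`, the `B₃`
bound by (2.2) and Lemma 2.2), `spaceCyl_subset_closedBall` (`…LerayLogHardy`), `angVortQuot_cutoff_energy_le`,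
`radVelQuot_curl_cutoff_energy_le` (`…Step3Gamma`), `integral_cutoff_sq_sub_eq`,
`continuousOn_integral_cutoff` (`…Step3Balance`), `fderiv_eq_zero_of_forall_notMem`
(`…CutoffDivCurl`),
`IsSmoothSpaceTimeOn.timeDerivWithin_angVortQuot / timeDerivWithin_radVelQuot /
timeDerivWithin_vorticity_eq`. Mathlib: `intervalIntegral.integral_mono_on`,
`intervalIntegral.integral_const`, `tsupport_mul_subset_left`, `measureReal_nonneg`.
`lean search 'cutoff_energy_apriori|keyEstimate|angVelQuot_mul_mul'`: no matches (2026-08-17).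

## References

* G. Seregin, J. Math. Fluid Mech. 24 (2022), Paper No. 27 = arXiv:2201.00153, §2 Step 3
  (arXiv pp. 6–7: the estimate of `B₃`, "Combining all the estimates…", the key estimate).
  [`Seregin2022LocalAxisym`]
-/

noncomputable section

open MeasureTheory Set Filter Topology Function Metric intervalIntegral
open scoped ENNReal ContDiff
open Literature.Analysis.FluidPDE

-- `<Problem> = <Summit>` duplicates a namespace component by design (lakefile sets the same option).
set_option linter.dupNamespace false

namespace Summit.NavierStokesRegularity.NavierStokesRegularity.Theorems.AxisymmetricKatoGlobal.EulerScaling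

/-! ### Absorption and the key estimate -/

section Apriori

/-- The horizontal gradient is bounded by the full gradient in `L²`: `∫ (∂₀f)² + (∂₁f)² ≤ ∫ |∇f|²`
for `f ∈ C¹` with compact support. [folklore] -/
theorem integral_horizontal_gradSq_le {f : EuclideanSpace ℝ (Fin 3) → ℝ} (hf : ContDiff ℝ 1 f)
    (hfc : HasCompactSupport f) :
    ∫ x, (fderiv ℝ f x (EuclideanSpace.single 0 1) ^ 2 + fderiv ℝ f x (EuclideanSpace.single 1 1) ^ 2) ≤
      ∫ x, (fderiv ℝ f x (EuclideanSpace.single 0 1) ^ 2 + fderiv ℝ f x (EuclideanSpace.single 1 1) ^ 2 + fderiv ℝ f x (EuclideanSpace.single 2 1) ^ 2) := by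
  have hi : ∀ i : Fin 3, Integrable (fun x => fderiv ℝ f x (EuclideanSpace.single i 1) ^ 2) := fun i =>
    ((continuous_fderiv_apply_of_contDiff hf _).pow 2).integrable_of_hasCompactSupport
      (hasCompactSupport_of_eq_zero (hfc.fderiv_apply ℝ (EuclideanSpace.single i 1)) fun x hx => by simp [hx])
  have h01 : Integrable (fun x => fderiv ℝ f x (EuclideanSpace.single 0 1) ^ 2 + fderiv ℝ f x (EuclideanSpace.single 1 1) ^ 2) := (hi 0).add (hi 1)
  exact integral_mono h01 (h01.add (hi 2)) fun x => by
    simp only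
    nlinarith [sq_nonneg (fderiv ℝ f x (EuclideanSpace.single 2 1))]

/-- **Continuity in time of the localised dissipation** `t ↦ ∫ |∇(ζ t · G t)|²` for `ζ, G` jointly
smooth on the open interval `S`, `ζ` vanishing off the compact `K`. [folklore] -/
theorem continuousOn_integral_gradSq_cutoff {S : Set ℝ} {ζ G : ℝ → EuclideanSpace ℝ (Fin 3) → ℝ}
    {K : Set (EuclideanSpace ℝ (Fin 3))} (hS : IsOpen S) (hζ : IsSmoothSpaceTimeOn S ζ)
    (hG : IsSmoothSpaceTimeOn S G) (hK : IsCompact K) (hsupp : ∀ t ∈ S, ∀ x ∉ K, ζ t x = 0) :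
    ContinuousOn (fun t => ∫ x,
      (fderiv ℝ (fun y => ζ t y * G t y) x (EuclideanSpace.single 0 1) ^ 2 +
        fderiv ℝ (fun y => ζ t y * G t y) x (EuclideanSpace.single 1 1) ^ 2 +
        fderiv ℝ (fun y => ζ t y * G t y) x (EuclideanSpace.single 2 1) ^ 2)) S := by
  have hU : UniqueDiffOn ℝ S := hS.uniqueDiffOn
  have hP : IsSmoothSpaceTimeOn S fun s y => ζ s y * G s y := hζ.mul hG
  have hPsupp : ∀ s ∈ S, ∀ x ∉ K, ζ s x * G s x = 0 := fun s hs x hx => by simp [hsupp s hs x hx]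
  have hDi : ∀ i : Fin 3, IsSmoothSpaceTimeOn S fun s x =>
      fderiv ℝ (fun y => ζ s y * G s y) x (EuclideanSpace.single i 1) := fun i => hP.fderiv_slice_apply hU _
  have hsmD : IsSmoothSpaceTimeOn S fun t x =>
      fderiv ℝ (fun y => ζ t y * G t y) x (EuclideanSpace.single 0 1) ^ 2 +
      fderiv ℝ (fun y => ζ t y * G t y) x (EuclideanSpace.single 1 1) ^ 2 +
      fderiv ℝ (fun y => ζ t y * G t y) x (EuclideanSpace.single 2 1) ^ 2 := by
    have := (((hDi 0).mul (hDi 0)).add ((hDi 1).mul (hDi 1))).add ((hDi 2).mul (hDi 2))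
    exact this.congr (fun z _ => by simp only [uncurry]; ring)
  refine continuousOn_integral_cutoff hK hsmD.continuousOn fun t ht x hx => ?_
  have h0 : fderiv ℝ (fun y => ζ t y * G t y) x = 0 :=
    fderiv_eq_zero_of_forall_notMem hK.isClosed (hPsupp t ht) hx
  simp [h0]

variable {T₀ T₁ ν : ℝ} {v : ℝ → EuclideanSpace ℝ (Fin 3) → EuclideanSpace ℝ (Fin 3)}
  {q : ℝ → EuclideanSpace ℝ (Fin 3) → ℝ} {ζ : ℝ → EuclideanSpace ℝ (Fin 3) → ℝ}

/-- **Seregin 2022, §2 Step 3 — the a-priori inequality behind the key estimate** (absorption of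
`B₃`; arXiv p. 7: "Combining all the estimates made on this step, we shall have
`½∂ₜ∫(Φη³)² + (Γη³)² + ∫(η³|∇Φ|)² + (η³|∇Γ|)² ≤ (cC₁/ln(e/r₁) + cC₁²/ln⁴(e/r₁))‖η³∇Γ‖‖η³∇Φ‖ + …`").
Classical axisymmetric solution on the open slab `(T₀, T₁)`, viscosity `ν ≥ 0`; cut-off `ζ = η³`
jointly smooth, axisymmetric, supported in the cylinder `𝒞 = spaceCyl 0 1`; `[t₁, t₂] ⊆ (T₀, T₁)`;
`Γ = angVortQuot (v t)`, `Φ = radVelQuot (curl (v t))`, `E(t) = ∫(ζΓ)² + ∫(ζΦ)²`,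
`D(t) = ∫|∇(ζΓ)|² + ∫|∇(ζΦ)|²`. Hypotheses, for `t ∈ [t₁, t₂]`: (2.2) in the form
`|σ| ≤ C₁/ln³(e/r)` on `0 < r < r₁ < 1`; the far-field bound `|(v_θ/r)(ζΓ)(ζΦ)| ≤ M` on `r ≥ r₁`
(the paper's "`(1/r₁)C(v,η)`", boundedness of `v`, `∇ω` off the axis); a bound `Bcut` for the
eight cut-off terms `A₁ + A₂ + B₁ + B₂` of the integrated `Γ`- and `Φ`-inequalities
(`…Step3Integrated`; the paper's `C(v,η)` from boundedness on `supp ∇η`); and the paper's bound of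
`A₃` in the printed form `2A₃ ≤ θ_A·D(t) + B_A` (its derivation uses Lemma 2.1). Conclusion: with
`θ = 8C₁/ln(e/r₁) + θ_A` (the `B₃`-part `8C₁/ln(e/r₁)` supplied here by
`abs_integral_angVelQuot_mul_mul_le` = (2.2) + Lemma 2.2), for every `t ∈ [t₁, t₂]`,
`E(t) + (2ν − θ)∫_{t₁}^t D ≤ E(t₁) + (Bcut + B_A + 4M|B(0,2)|)(t − t₁)`.
[cite: Seregin2022LocalAxisym, §2 Step 3 (arXiv:2201.00153 p. 7, "Combining all the estimates made on this step")] -/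
theorem cutoff_energy_apriori : ∀ (T₀ T₁ ν : ℝ) (v : ℝ → EuclideanSpace ℝ (Fin 3) → EuclideanSpace ℝ (Fin 3)) (q : ℝ → EuclideanSpace ℝ (Fin 3) → ℝ) (ζ : ℝ → EuclideanSpace ℝ (Fin 3) → ℝ) (t₁ t₂ C₁ r₁ M θA BA Bcut : ℝ), IsClassicalNSSolutionOn (Ioo T₀ T₁) ν 0 v q → (∀ s ∈ Ioo T₀ T₁, IsAxisymmetric (v s)) → 0 ≤ ν → IsSmoothSpaceTimeOn (Ioo T₀ T₁) ζ → (∀ s ∈ Ioo T₀ T₁, IsAxisymmetricScalar (ζ s)) → (∀ s ∈ Ioo T₀ T₁, tsupport (ζ s) ⊆ SereginSverak2009.spaceCyl 0 1) → Icc t₁ t₂ ⊆ Ioo T₀ T₁ → 0 ≤ C₁ → 0 < r₁ → r₁ < 1 → 0 ≤ M → (∀ t ∈ Icc t₁ t₂, ∀ x, 0 < cylRadius x → cylRadius x < r₁ → |swirl (v t) x| ≤ C₁ / Real.log (Real.exp 1 / cylRadius x) ^ 3) → (∀ t ∈ Icc t₁ t₂, ∀ x, r₁ ≤ cylRadius x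 → |angVelQuot (v t) x * (ζ t x * angVortQuot (v t) x) * (ζ t x * radVelQuot (curl (v t)) x)| ≤ M) → (∀ t ∈ Icc t₁ t₂, (2 * (∫ x, ζ t x * timeDerivWithin (Ioo T₀ T₁) ζ t x * angVortQuot (v t) x ^ 2) + 2 * (∫ x, ζ t x * angVortQuot (v t) x ^ 2 * fderiv ℝ (ζ t) x (v t x)) + 2 * ν * (∫ x, angVortQuot (v t) x ^ 2 * (fderiv ℝ (ζ t) x (EuclideanSpace.single 0 1) ^ 2 + fderiv ℝ (ζ t) x (EuclideanSpace.single 1 1) ^ 2 + fderiv ℝ (ζ t) x (EuclideanSpace.single 2 1) ^ 2)) - 4 * ν * (∫ x, ζ t x * angVortQuot (v t) x ^ 2 * radDerivQuot (ζ t) x)) + (2 * (∫ x, ζ t x * timeDerivWithin (Ioo T₀ T₁) ζ t x * radVelQuot (curl (v t)) x ^ 2) + 2 * (∫ x, ζ t x * radVelQuot (curl (v t)) x ^ 2 * fderiv ℝ (ζ t) x (v t x)) + 2 * ν * (∫ x, radVelQuot (curl (v t)) x ^ 2 * (fderiv ℝ (ζ t) x (EuclideanSpace.single 0 1) ^ 2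 + fderiv ℝ (ζ t) x (EuclideanSpace.single 1 1) ^ 2 + fderiv ℝ (ζ t) x (EuclideanSpace.single 2 1) ^ 2)) - 4 * ν * (∫ x, ζ t x * radVelQuot (curl (v t)) x ^ 2 * radDerivQuot (ζ t) x)) ≤ Bcut) → (∀ t ∈ Icc t₁ t₂, 2 * (∫ x, ζ t x ^ 2 * radVelQuot (curl (v t)) x * fderiv ℝ (radVelQuot (v t)) x (curl (v t) x)) ≤ θA * ((∫ x, (fderiv ℝ (fun y => ζ t y * angVortQuot (v t) y) x (EuclideanSpace.single 0 1) ^ 2 + fderiv ℝ (fun y => ζ t y * angVortQuot (v t) y) x (EuclideanSpace.single 1 1) ^ 2 + fderiv ℝ (fun y => ζ t y * angVortQuot (v t) y) x (EuclideanSpace.single 2 1) ^ 2)) + (∫ x, (fderiv ℝ (fun y => ζ t y * radVelQuot (curl (v t)) y) x (EuclideanSpace.single 0 1) ^ 2 + fderiv ℝ (fun y => ζ t y * radVelQuot (curl (v t)) y) x (EuclideanSpace.single 1 1) ^ 2 + fderiv ℝ (fun y => ζ t y * radVelQuot (curl (v t)) y) x (EuclideanSpace.single 2 1) ^ 2)))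 + BA) → ∀ t ∈ Icc t₁ t₂, (∫ x, (ζ t x * angVortQuot (v t) x) ^ 2) + (∫ x, (ζ t x * radVelQuot (curl (v t)) x) ^ 2) + (2 * ν - 8 * C₁ / Real.log (Real.exp 1 / r₁) - θA) * ∫ s in t₁..t, ((∫ x, (fderiv ℝ (fun y => ζ s y * angVortQuot (v s) y) x (EuclideanSpace.single 0 1) ^ 2 + fderiv ℝ (fun y => ζ s y * angVortQuot (v s) y) x (EuclideanSpace.single 1 1) ^ 2 + fderiv ℝ (fun y => ζ s y * angVortQuot (v s) y) x (EuclideanSpace.single 2 1) ^ 2)) + (∫ x, (fderiv ℝ (fun y => ζ s y * radVelQuot (curl (v s)) y) x (EuclideanSpace.single 0 1) ^ 2 + fderiv ℝ (fun y => ζ s y * radVelQuot (curl (v s)) y) x (EuclideanSpace.single 1 1) ^ 2 + fderiv ℝ (fun y => ζ s y * radVelQuot (curl (v s)) y) x (EuclideanSpace.single 2 1) ^ 2))) ≤ (∫ x, (ζ t₁ x * angVortQuot (v t₁) x) ^ 2) + (∫ x, (ζ t₁ x * radVelQuot (curl (v t₁)) x) ^ 2) + (Bcut + BA + 4 * M *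 volume.real (closedBall (0 : EuclideanSpace ℝ (Fin 3)) 2)) * (t - t₁) := by
  intro T₀ T₁ ν v q ζ t₁ t₂ C₁ r₁ M θA BA Bcut hns hax hν hζ hζax hζs hsub hC₁ hr₁ hr₁1 hM hσ hfar hcut hA3 t ht
  set S : Set ℝ := Ioo T₀ T₁ with hSdef
  have hS : IsOpen S := isOpen_Ioo
  have hU : UniqueDiffOn ℝ S := hS.uniqueDiffOn
  have hc : Convex ℝ S := convex_Ioo T₀ T₁
  have hcl : S ⊆ closure (interior S) := by rw [hSdef, isOpen_Ioo.interior_eq]; exact subset_closure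
  have hsm : IsSmoothSpaceTimeOn S v := hns.smooth_velocity
  have hΓ : IsSmoothSpaceTimeOn S fun s => angVortQuot (v s) := hsm.angVortQuot_family hc hU
  have hω : IsSmoothSpaceTimeOn S (vorticity v) := hsm.isSmoothSpaceTimeOn_vorticity hU
  have haxω : ∀ s ∈ S, IsAxisymmetric (vorticity v s) := fun s hs =>
    (hax s hs).curl ((hsm.contDiff_slice hs).differentiable (by simp))
  have hJ : IsSmoothSpaceTimeOn S fun s => radVelQuot (curl (v s)) := hω.radVelQuot_family hc hU
  -- the cut-off vanishes off the ball `B(0,2)`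
  have hK : IsCompact (closedBall (0 : EuclideanSpace ℝ (Fin 3)) 2) := isCompact_closedBall _ _
  have hsupp : ∀ s ∈ S, ∀ x ∉ closedBall (0 : EuclideanSpace ℝ (Fin 3)) 2, ζ s x = 0 :=
    fun s hs x hx => image_eq_zero_of_notMem_tsupport fun h => hx (spaceCyl_subset_closedBall (hζs s hs h))
  have ht1S : Icc t₁ t ⊆ S := (Icc_subset_Icc_right ht.2).trans hsub
  -- the energy balances on `[t₁, t]`
  obtain ⟨hdensΓ, hbalΓ⟩ := integral_cutoff_sq_sub_eq hS hζ hΓ hK hsupp ht.1 ht1S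
  obtain ⟨hdensJ, hbalJ⟩ := integral_cutoff_sq_sub_eq hS hζ hJ hK hsupp ht.1 ht1S
  -- continuity of the dissipations
  have cDΓ := continuousOn_integral_gradSq_cutoff hS hζ hΓ hK hsupp
  have cDJ := continuousOn_integral_gradSq_cutoff hS hζ hJ hK hsupp
  -- the pointwise-in-time inequality
  have hpt : ∀ s ∈ Icc t₁ t,
      (2 * (∫ x, ζ s x * timeDerivWithin S ζ s x * angVortQuot (v s) x ^ 2) +
        2 * ∫ x, ζ s x ^ 2 * angVortQuot (v s) x * timeDerivWithin S (fun r => angVortQuot (v r)) s x) +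
      (2 * (∫ x, ζ s x * timeDerivWithin S ζ s x * radVelQuot (curl (v s)) x ^ 2) +
        2 * ∫ x, ζ s x ^ 2 * radVelQuot (curl (v s)) x * timeDerivWithin S (fun r => radVelQuot (curl (v r))) s x) +
      (2 * ν - 8 * C₁ / Real.log (Real.exp 1 / r₁) - θA) * ((∫ x, (fderiv ℝ (fun y => ζ s y * angVortQuot (v s) y) x (EuclideanSpace.single 0 1) ^ 2 + fderiv ℝ (fun y => ζ s y * angVortQuot (v s) y) x (EuclideanSpace.single 1 1) ^ 2 + fderiv ℝ (fun y => ζ s y * angVortQuot (v s) y) x (EuclideanSpace.single 2 1) ^ 2)) + (∫ x, (fderiv ℝ (fun y => ζ s y * radVelQuot (curl (v s)) y) x (EuclideanSpace.single 0 1) ^ 2 + fderiv ℝ (fun y => ζ s y * radVelQuot (curl (v s)) y) x (EuclideanSpace.single 1 1) ^ 2 + fderiv ℝ (fun y => ζ s y * radVelQuot (curl (v s)) y) x (EuclideanSpace.single 2 1) ^ 2))) ≤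
      Bcut + BA + 4 * M * volume.real (closedBall (0 : EuclideanSpace ℝ (Fin 3)) 2) := by
    intro s hs1
    have hs12 : s ∈ Icc t₁ t₂ := ⟨hs1.1, hs1.2.trans ht.2⟩
    have hs : s ∈ S := hsub hs12
    have hvs : ContDiff ℝ ∞ (v s) := hns.contDiff_velocity hs
    have hv2 : ContDiff ℝ 2 (v s) := hvs.of_le (by norm_cast)
    have hζ2 : ContDiff ℝ 2 (ζ s) := (hζ.contDiff_slice hs).of_le (by norm_cast)
    have hζ1 : ContDiff ℝ 1 (ζ s) := (hζ.contDiff_slice hs).of_le (by norm_cast)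
    have hζc : HasCompactSupport (ζ s) := HasCompactSupport.intro hK (hsupp s hs)
    have hΓ1 : ContDiff ℝ 1 (angVortQuot (v s)) := ((hΓ.contDiff_slice hs).of_le (by norm_cast) : ContDiff ℝ 1 _)
    have hJ1 : ContDiff ℝ 1 (radVelQuot (curl (v s))) := ((hJ.contDiff_slice hs).of_le (by norm_cast) : ContDiff ℝ 1 _)
    -- fixed-time inequalities
    have hfixΓ := angVortQuot_cutoff_energy_le S ν v q (ζ s) s hns hU hcl hax hν hs hζ2 (hζax s hs) hζc
    have hfixJ := radVelQuot_curl_cutoff_energy_le S ν v q (ζ s) s hns hU hcl hax hν hs hζ2 (hζax s hs) hζc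
    have hderΓ : ∀ x, timeDerivWithin S (fun r => angVortQuot (v r)) s x =
        angVortQuot (timeDerivWithin S v s) x := fun x => hsm.timeDerivWithin_angVortQuot hc hU hcl hax hs x
    have hderJ : ∀ x, timeDerivWithin S (fun r => radVelQuot (curl (v r))) s x =
        radVelQuot (curl (timeDerivWithin S v s)) x := fun x => by
      have h1 := hω.timeDerivWithin_radVelQuot hc hU haxω hs x
      rw [hsm.timeDerivWithin_vorticity_eq hU hcl hs] at h1
      exact h1
    have heqΓ : ∫ x, ζ s x ^ 2 * angVortQuot (v s) x * timeDerivWithin S (fun r => angVortQuot (v r)) s x =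
        ∫ x, ζ s x ^ 2 * angVortQuot (v s) x * angVortQuot (timeDerivWithin S v s) x :=
      integral_congr_ae (Eventually.of_forall fun x => by beta_reduce; rw [hderΓ x])
    have heqJ : ∫ x, ζ s x ^ 2 * radVelQuot (curl (v s)) x * timeDerivWithin S (fun r => radVelQuot (curl (v r))) s x =
        ∫ x, ζ s x ^ 2 * radVelQuot (curl (v s)) x * radVelQuot (curl (timeDerivWithin S v s)) x :=
      integral_congr_ae (Eventually.of_forall fun x => by beta_reduce; rw [hderJ x])
    -- the `B₃` bound
    have hfΓ : ContDiff ℝ 1 fun x => ζ s x * angVortQuot (v s) x := hζ1.mul hΓ1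
    have hfJ : ContDiff ℝ 1 fun x => ζ s x * radVelQuot (curl (v s)) x := hζ1.mul hJ1
    have hsΓ : tsupport (fun x => ζ s x * angVortQuot (v s) x) ⊆ SereginSverak2009.spaceCyl 0 1 :=
      tsupport_mul_subset_left.trans (hζs s hs)
    have hsJ : tsupport (fun x => ζ s x * radVelQuot (curl (v s)) x) ⊆ SereginSverak2009.spaceCyl 0 1 :=
      tsupport_mul_subset_left.trans (hζs s hs)
    have hB3 := abs_integral_angVelQuot_mul_mul_le (v s) _ _ C₁ r₁ M (hax s hs) hv2 hfΓ hfJ hsΓ hsJ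
      hC₁ hr₁ hr₁1 hM (hσ s hs12) (hfar s hs12)
    have hB3eq : ∫ x, ζ s x ^ 2 * angVortQuot (v s) x * (angVelQuot (v s) x * radVelQuot (curl (v s)) x) =
        ∫ x, angVelQuot (v s) x * (ζ s x * angVortQuot (v s) x) * (ζ s x * radVelQuot (curl (v s)) x) :=
      integral_congr_ae (Eventually.of_forall fun x => by ring)
    -- horizontal gradients are bounded by full gradients
    have hHΓ : ∫ x, (fderiv ℝ (fun y => ζ s y * angVortQuot (v s) y) x (EuclideanSpace.single 0 1) ^ 2 + fderiv ℝ (fun y => ζ s y * angVortQuot (v s) y) x (EuclideanSpace.single 1 1) ^ 2) ≤ (∫ x, (fderiv ℝ (fun y => ζ s y * angVortQuot (v s) y) x (EuclideanSpace.single 0 1) ^ 2 + fderiv ℝ (fun y => ζ s y * angVortQuot (v s) y) x (EuclideanSpace.single 1 1) ^ 2 + fderiv ℝ (fun y => ζ s y * angVortQuot (v s) y) x (EuclideanSpace.single 2 1) ^ 2)) :=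
      integral_horizontal_gradSq_le hfΓ (hζc.mul_right)
    have hHJ : ∫ x, (fderiv ℝ (fun y => ζ s y * radVelQuot (curl (v s)) y) x (EuclideanSpace.single 0 1) ^ 2 + fderiv ℝ (fun y => ζ s y * radVelQuot (curl (v s)) y) x (EuclideanSpace.single 1 1) ^ 2) ≤ (∫ x, (fderiv ℝ (fun y => ζ s y * radVelQuot (curl (v s)) y) x (EuclideanSpace.single 0 1) ^ 2 + fderiv ℝ (fun y => ζ s y * radVelQuot (curl (v s)) y) x (EuclideanSpace.single 1 1) ^ 2 + fderiv ℝ (fun y => ζ s y * radVelQuot (curl (v s)) y) x (EuclideanSpace.single 2 1) ^ 2)) :=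
      integral_horizontal_gradSq_le hfJ (hζc.mul_right)
    have hL₁0 : 0 < Real.log (Real.exp 1 / r₁) := by
      rw [log_exp_div_eq r₁ hr₁]; linarith [Real.log_neg hr₁ hr₁1]
    have hcoef : 0 ≤ 2 * C₁ / Real.log (Real.exp 1 / r₁) := by positivity
    have hB3' : |∫ x, angVelQuot (v s) x * (ζ s x * angVortQuot (v s) x) * (ζ s x * radVelQuot (curl (v s)) x)| ≤
        2 * C₁ / Real.log (Real.exp 1 / r₁) * ((∫ x, (fderiv ℝ (fun y => ζ s y * angVortQuot (v s) y) x (EuclideanSpace.single 0 1) ^ 2 + fderiv ℝ (fun y => ζ s y * angVortQuot (v s) y) x (EuclideanSpace.single 1 1) ^ 2 + fderiv ℝ (fun y => ζ s y * angVortQuot (v s) y) x (EuclideanSpace.single 2 1) ^ 2)) + (∫ x, (fderiv ℝ (fun y => ζ s y * radVelQuot (curl (v s)) y) x (EuclideanSpace.single 0 1) ^ 2 + fderiv ℝ (fun y => ζ s y * radVelQuot (curl (v s)) y) x (EuclideanSpace.single 1 1) ^ 2 + fderiv ℝ (fun y => ζ s y * radVelQuot (curl (v s)) y) x (EuclideanSpace.single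 2 1) ^ 2))) +
          M * volume.real (closedBall (0 : EuclideanSpace ℝ (Fin 3)) 2) := by
      refine hB3.trans ?_
      gcongr
    have habs := abs_le.1 hB3'
    have hcut' := hcut s hs12
    have hA3' := hA3 s hs12
    rw [heqΓ, heqJ]
    rw [hB3eq] at hfixΓ
    have h8 : 8 * C₁ / Real.log (Real.exp 1 / r₁) * ((∫ x, (fderiv ℝ (fun y => ζ s y * angVortQuot (v s) y) x (EuclideanSpace.single 0 1) ^ 2 + fderiv ℝ (fun y => ζ s y * angVortQuot (v s) y) x (EuclideanSpace.single 1 1) ^ 2 + fderiv ℝ (fun y => ζ s y * angVortQuot (v s) y) x (EuclideanSpace.single 2 1) ^ 2)) + (∫ x, (fderiv ℝ (fun y => ζ s y * radVelQuot (curl (v s)) y) x (EuclideanSpace.single 0 1) ^ 2 + fderiv ℝ (fun y => ζ s y * radVelQuot (curl (v s)) y) x (EuclideanSpace.single 1 1) ^ 2 + fderiv ℝ (fun y => ζ s y * radVelQuot (curl (v s)) y) x (EuclideanSpace.single 2 1) ^ 2))) =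
        4 * (2 * C₁ / Real.log (Real.exp 1 / r₁) * ((∫ x, (fderiv ℝ (fun y => ζ s y * angVortQuot (v s) y) x (EuclideanSpace.single 0 1) ^ 2 + fderiv ℝ (fun y => ζ s y * angVortQuot (v s) y) x (EuclideanSpace.single 1 1) ^ 2 + fderiv ℝ (fun y => ζ s y * angVortQuot (v s) y) x (EuclideanSpace.single 2 1) ^ 2)) + (∫ x, (fderiv ℝ (fun y => ζ s y * radVelQuot (curl (v s)) y) x (EuclideanSpace.single 0 1) ^ 2 + fderiv ℝ (fun y => ζ s y * radVelQuot (curl (v s)) y) x (EuclideanSpace.single 1 1) ^ 2 + fderiv ℝ (fun y => ζ s y * radVelQuot (curl (v s)) y) x (EuclideanSpace.single 2 1) ^ 2)))) := by ring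
    nlinarith [hfixΓ, hfixJ, habs.1, habs.2, hcut', hA3', h8]
  -- integrate over `[t₁, t]`
  have hIdensΓ := (hdensΓ.mono ht1S).intervalIntegrable_of_Icc (μ := volume) ht.1
  have hIdensJ := (hdensJ.mono ht1S).intervalIntegrable_of_Icc (μ := volume) ht.1
  have hID : IntervalIntegrable (fun s => (∫ x, (fderiv ℝ (fun y => ζ s y * angVortQuot (v s) y) x (EuclideanSpace.single 0 1) ^ 2 + fderiv ℝ (fun y => ζ s y * angVortQuot (v s) y) x (EuclideanSpace.single 1 1) ^ 2 + fderiv ℝ (fun y => ζ s y * angVortQuot (v s) y) x (EuclideanSpace.single 2 1) ^ 2)) + (∫ x, (fderiv ℝ (fun y => ζ s y * radVelQuot (curl (v s)) y) x (EuclideanSpace.single 0 1) ^ 2 + fderiv ℝ (fun y => ζ s y * radVelQuot (curl (v s)) y) x (EuclideanSpace.single 1 1) ^ 2 + fderiv ℝ (fun y => ζ s y * radVelQuot (curl (v s)) y) x (EuclideanSpace.single 2 1) ^ 2))) volume t₁ t :=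
    ((cDΓ.add cDJ).mono ht1S).intervalIntegrable_of_Icc (μ := volume) ht.1
  have hmono := intervalIntegral.integral_mono_on ht.1
    ((hIdensΓ.add hIdensJ).add (hID.const_mul (2 * ν - 8 * C₁ / Real.log (Real.exp 1 / r₁) - θA)))
    intervalIntegrable_const hpt
  rw [intervalIntegral.integral_add (hIdensΓ.add hIdensJ)
      (hID.const_mul (2 * ν - 8 * C₁ / Real.log (Real.exp 1 / r₁) - θA)),
    intervalIntegral.integral_add hIdensΓ hIdensJ, intervalIntegral.integral_const_mul,
    intervalIntegral.integral_const, smul_eq_mul] at hmono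
  linarith [hbalΓ, hbalJ, hmono]

/-- **Seregin 2022, §2 Step 3 — the key estimate** (arXiv p. 7: "Here, it is assumed that a
number `r₁ ∈ ]0,1/4[` so small as `cC₁/ln(e/r₁) + cC₁²/ln⁴(e/|r₁|) < 2`. So, if the latter
condition holds, the key estimate can be derived by more or less standard arguments. It is as
follows: `sup_{-1<t<0}∫_𝒞 η⁶(|Γ|² + |Φ|²)dx + ∫_Q (η³|∇Φ|)² + (η³|∇Γ|)² dxdt ≤ C(v,η,r₁)`").
Under the hypotheses of `cutoff_energy_apriori` and the smallness `8C₁/ln(e/r₁) + θ_A < 2ν`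
(`exists_radius_logSmall`), with `K = E(t₁) + (Bcut + B_A + 4M|B(0,2)|)(t₂ − t₁)`
(`E(t₁) = 0` when `ζ(t₁) = 0`, i.e. `ξ(t₁) = 0`):
`sup_{t ∈ [t₁,t₂]} (∫(ζΓ)² + ∫(ζΦ)²)(t) ≤ K` and
`∫_{t₁}^{t₂} (∫|∇(ζΓ)|² + ∫|∇(ζΦ)|²) dt ≤ K/(2ν − 8C₁/ln(e/r₁) − θ_A)`, in the `η³G`-form consumed
by Step 4 (`|η³Φ|²_{2,Q} + |η³Γ|²_{2,Q} < ∞`).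
[cite: Seregin2022LocalAxisym, §2 Step 3 (arXiv:2201.00153 p. 7, the key estimate)] -/
theorem cutoff_energy_keyEstimate : ∀ (T₀ T₁ ν : ℝ) (v : ℝ → EuclideanSpace ℝ (Fin 3) → EuclideanSpace ℝ (Fin 3)) (q : ℝ → EuclideanSpace ℝ (Fin 3) → ℝ) (ζ : ℝ → EuclideanSpace ℝ (Fin 3) → ℝ) (t₁ t₂ C₁ r₁ M θA BA Bcut : ℝ), IsClassicalNSSolutionOn (Ioo T₀ T₁) ν 0 v q → (∀ s ∈ Ioo T₀ T₁, IsAxisymmetric (v s)) → 0 ≤ ν → IsSmoothSpaceTimeOn (Ioo T₀ T₁) ζ → (∀ s ∈ Ioo T₀ T₁, IsAxisymmetricScalar (ζ s)) → (∀ s ∈ Ioo T₀ T₁, tsupport (ζ s) ⊆ SereginSverak2009.spaceCyl 0 1) → Icc t₁ t₂ ⊆ Ioo T₀ T₁ → 0 ≤ C₁ → 0 < r₁ → r₁ < 1 → 0 ≤ M → (∀ t ∈ Icc t₁ t₂, ∀ x, 0 < cylRadius x → cylRadius x < r₁ → |swirl (v t) x| ≤ C₁ / Real.log (Real.exp 1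 / cylRadius x) ^ 3) → (∀ t ∈ Icc t₁ t₂, ∀ x, r₁ ≤ cylRadius x → |angVelQuot (v t) x * (ζ t x * angVortQuot (v t) x) * (ζ t x * radVelQuot (curl (v t)) x)| ≤ M) → (∀ t ∈ Icc t₁ t₂, (2 * (∫ x, ζ t x * timeDerivWithin (Ioo T₀ T₁) ζ t x * angVortQuot (v t) x ^ 2) + 2 * (∫ x, ζ t x * angVortQuot (v t) x ^ 2 * fderiv ℝ (ζ t) x (v t x)) + 2 * ν * (∫ x, angVortQuot (v t) x ^ 2 * (fderiv ℝ (ζ t) x (EuclideanSpace.single 0 1) ^ 2 + fderiv ℝ (ζ t) x (EuclideanSpace.single 1 1) ^ 2 + fderiv ℝ (ζ t) x (EuclideanSpace.single 2 1) ^ 2)) - 4 * ν * (∫ x, ζ t x * angVortQuot (v t) x ^ 2 * radDerivQuot (ζ t) x)) + (2 * (∫ x, ζ t x * timeDerivWithin (Ioo T₀ T₁) ζ t x * radVelQuot (curl (v t)) x ^ 2) + 2 * (∫ x, ζ t x * radVelQuot (curl (v t)) x ^ 2 * fderiv ℝ (ζ t) x (v t x)) + 2 * ν * (∫ x, radVelQuot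 (curl (v t)) x ^ 2 * (fderiv ℝ (ζ t) x (EuclideanSpace.single 0 1) ^ 2 + fderiv ℝ (ζ t) x (EuclideanSpace.single 1 1) ^ 2 + fderiv ℝ (ζ t) x (EuclideanSpace.single 2 1) ^ 2)) - 4 * ν * (∫ x, ζ t x * radVelQuot (curl (v t)) x ^ 2 * radDerivQuot (ζ t) x)) ≤ Bcut) → (∀ t ∈ Icc t₁ t₂, 2 * (∫ x, ζ t x ^ 2 * radVelQuot (curl (v t)) x * fderiv ℝ (radVelQuot (v t)) x (curl (v t) x)) ≤ θA * ((∫ x, (fderiv ℝ (fun y => ζ t y * angVortQuot (v t) y) x (EuclideanSpace.single 0 1) ^ 2 + fderiv ℝ (fun y => ζ t y * angVortQuot (v t) y) x (EuclideanSpace.single 1 1) ^ 2 + fderiv ℝ (fun y => ζ t y * angVortQuot (v t) y) x (EuclideanSpace.single 2 1) ^ 2)) + (∫ x, (fderiv ℝ (fun y => ζ t y * radVelQuot (curl (v t)) y) x (EuclideanSpace.single 0 1) ^ 2 + fderiv ℝ (fun y => ζ t y * radVelQuot (curl (v t)) y) x (EuclideanSpace.single 1 1) ^ 2 + fderiv ℝ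 (fun y => ζ t y * radVelQuot (curl (v t)) y) x (EuclideanSpace.single 2 1) ^ 2))) + BA) → 0 ≤ Bcut → 0 ≤ BA → 8 * C₁ / Real.log (Real.exp 1 / r₁) + θA < 2 * ν → t₁ ≤ t₂ → (∀ t ∈ Icc t₁ t₂, (∫ x, (ζ t x * angVortQuot (v t) x) ^ 2) + (∫ x, (ζ t x * radVelQuot (curl (v t)) x) ^ 2) ≤ (∫ x, (ζ t₁ x * angVortQuot (v t₁) x) ^ 2) + (∫ x, (ζ t₁ x * radVelQuot (curl (v t₁)) x) ^ 2) + (Bcut + BA + 4 * M * volume.real (closedBall (0 : EuclideanSpace ℝ (Fin 3)) 2)) * (t₂ - t₁)) ∧ ∫ s in t₁..t₂, ((∫ x, (fderiv ℝ (fun y => ζ s y * angVortQuot (v s) y) x (EuclideanSpace.single 0 1) ^ 2 + fderiv ℝ (fun y => ζ s y * angVortQuot (v s) y) x (EuclideanSpace.single 1 1) ^ 2 + fderiv ℝ (fun y => ζ s y * angVortQuot (v s) y) x (EuclideanSpace.single 2 1) ^ 2)) + (∫ x, (fderiv ℝ (fun y => ζ s y * radVelQuot (curl (v s)) y) x (EuclideanSpace.single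 0 1) ^ 2 + fderiv ℝ (fun y => ζ s y * radVelQuot (curl (v s)) y) x (EuclideanSpace.single 1 1) ^ 2 + fderiv ℝ (fun y => ζ s y * radVelQuot (curl (v s)) y) x (EuclideanSpace.single 2 1) ^ 2))) ≤ ((∫ x, (ζ t₁ x * angVortQuot (v t₁) x) ^ 2) + (∫ x, (ζ t₁ x * radVelQuot (curl (v t₁)) x) ^ 2) + (Bcut + BA + 4 * M * volume.real (closedBall (0 : EuclideanSpace ℝ (Fin 3)) 2)) * (t₂ - t₁)) / (2 * ν - 8 * C₁ / Real.log (Real.exp 1 / r₁) - θA) := by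
  intro T₀ T₁ ν v q ζ t₁ t₂ C₁ r₁ M θA BA Bcut hns hax hν hζ hζax hζs hsub hC₁ hr₁ hr₁1 hM hσ hfar hcut hA3 hBcut hBA hsmall h12
  have hap := cutoff_energy_apriori T₀ T₁ ν v q ζ t₁ t₂ C₁ r₁ M θA BA Bcut hns hax hν hζ hζax hζs hsub hC₁
    hr₁ hr₁1 hM hσ hfar hcut hA3
  have hVOL : 0 ≤ volume.real (closedBall (0 : EuclideanSpace ℝ (Fin 3)) 2) := measureReal_nonneg
  have hB : 0 ≤ Bcut + BA + 4 * M * volume.real (closedBall (0 : EuclideanSpace ℝ (Fin 3)) 2) := by positivity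
  have hpos : 0 < 2 * ν - 8 * C₁ / Real.log (Real.exp 1 / r₁) - θA := by linarith
  -- the dissipation is nonnegative
  have hDnn : ∀ s, 0 ≤ (∫ x, (fderiv ℝ (fun y => ζ s y * angVortQuot (v s) y) x (EuclideanSpace.single 0 1) ^ 2 + fderiv ℝ (fun y => ζ s y * angVortQuot (v s) y) x (EuclideanSpace.single 1 1) ^ 2 + fderiv ℝ (fun y => ζ s y * angVortQuot (v s) y) x (EuclideanSpace.single 2 1) ^ 2)) + (∫ x, (fderiv ℝ (fun y => ζ s y * radVelQuot (curl (v s)) y) x (EuclideanSpace.single 0 1) ^ 2 + fderiv ℝ (fun y => ζ s y * radVelQuot (curl (v s)) y) x (EuclideanSpace.single 1 1) ^ 2 + fderiv ℝ (fun y => ζ s y * radVelQuot (curl (v s)) y) x (EuclideanSpace.single 2 1) ^ 2)) := fun s =>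
    add_nonneg (integral_nonneg fun x => by positivity) (integral_nonneg fun x => by positivity)
  have hIDnn : ∀ t, t₁ ≤ t → 0 ≤ ∫ s in t₁..t, ((∫ x, (fderiv ℝ (fun y => ζ s y * angVortQuot (v s) y) x (EuclideanSpace.single 0 1) ^ 2 + fderiv ℝ (fun y => ζ s y * angVortQuot (v s) y) x (EuclideanSpace.single 1 1) ^ 2 + fderiv ℝ (fun y => ζ s y * angVortQuot (v s) y) x (EuclideanSpace.single 2 1) ^ 2)) + (∫ x, (fderiv ℝ (fun y => ζ s y * radVelQuot (curl (v s)) y) x (EuclideanSpace.single 0 1) ^ 2 + fderiv ℝ (fun y => ζ s y * radVelQuot (curl (v s)) y) x (EuclideanSpace.single 1 1) ^ 2 + fderiv ℝ (fun y => ζ s y * radVelQuot (curl (v s)) y) x (EuclideanSpace.single 2 1) ^ 2))) := fun t ht =>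
    intervalIntegral.integral_nonneg ht fun s _ => hDnn s
  refine ⟨fun t ht => ?_, ?_⟩
  · have h := hap t ht
    have h1 : (Bcut + BA + 4 * M * volume.real (closedBall (0 : EuclideanSpace ℝ (Fin 3)) 2)) * (t - t₁) ≤ (Bcut + BA + 4 * M * volume.real (closedBall (0 : EuclideanSpace ℝ (Fin 3)) 2)) * (t₂ - t₁) :=
      mul_le_mul_of_nonneg_left (by linarith [ht.2]) hB
    nlinarith [hIDnn t ht.1, mul_nonneg hpos.le (hIDnn t ht.1)]
  · have h := hap t₂ ⟨h12, le_rfl⟩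
    have hE : 0 ≤ (∫ x, (ζ t₂ x * angVortQuot (v t₂) x) ^ 2) + (∫ x, (ζ t₂ x * radVelQuot (curl (v t₂)) x) ^ 2) :=
      add_nonneg (integral_nonneg fun x => by positivity) (integral_nonneg fun x => by positivity)
    rw [le_div_iff₀ hpos]
    nlinarith [hIDnn t₂ h12]

end Apriori

end Summit.NavierStokesRegularity.NavierStokesRegularity.Theorems.AxisymmetricKatoGlobal.EulerScaling

end
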